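import Literature.NumberTheory.Sieve.HeathBrownCubicPrimes
import Literature.NumberTheory.LFunctions.LogIntegral
import HarnessLib

/-!
# Primes `x³ + 2y³` (Heath-Brown 2001), layer 2: the outline of §2 — (2.3) + (2.4) ⇒ (2.2)

Topic `Literature/NumberTheory/Sieve`; second layer (below `HeathBrownCubicPrimes.lean`) of the
decomposition of `Literature.NumberTheory.Sieve.setOf_prime_cube_add_two_mul_cube_infinite` (**parity.S18**).
Source: D. R. Heath-Brown, *Primes represented by `x³ + 2y³`*, Acta Math. 186 (2001) 1–84
[HeathBrownActa2001], §2 "A broad outline of the proof", pp. 4–5, displays (2.2)–(2.4), and the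
identification of first-degree prime ideals with cube roots of `2` (remark after Lemma 2.2, p. 6;
Dedekind's theorem as used on p. 21).

Heath-Brown proves the quantitative theorem (2.2) (vendored one layer up as
`HeathBrown2001_primePairCount_asymptotic`) by comparing `𝒜` with the sequence
`ℬ = {N(J) : J ⊴ 𝓞_K, N(J) ∈ (3X³, 3X³(1+η)]}` of ideal norms of `K = ℚ(2^{1/3})` (p. 5): the
prime ideal theorem (2.3) evaluates `π(ℬ)`, and the whole sieve argument of §§3–13 is summarised
in the single comparison (2.4), `π(𝒜) = κ π(ℬ) + O(η²X²(log X)^{−1}(log log X)^{−1/6})` with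
`κ = σ₀ η (3X)^{−1}` (p. 5; obtained on p. 21 from (3.15)). "In order to establish (2.2) it
therefore suffices to show (2.4)" (p. 5) is the step PROVED in this file.

## Content (namespace `Literature.CubicPrimes`)

* `firstDegreePrimeCount x = π⁽¹⁾_K(x) = ∑_{p ≤ x} ν_p` — the number of first-degree prime ideals
  of `𝓞_K = ℤ[2^{1/3}]` of norm `≤ x`, in the elementary form given by Dedekind's theorem
  (p. 21: the first-degree primes above `p` are the `(p, n − 2^{1/3})`, `n³ ≡ 2 (mod p)`, so
  there are `ν_p` of them; p. 6: this `ν_p` "agrees with that defined in the statement of our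
  theorem").
* `normPrimeCount X η = π(ℬ) = ∑_{3X³ < p ≤ 3X³(1+η)} ν_p` — the number of primes of `ℬ`
  counted with multiplicity ("the primes in `ℬ` therefore correspond to first degree prime
  ideals", p. 5), again in elementary form. API: `normPrimeCount_eq_sub`
  (`π(ℬ) = π⁽¹⁾_K(3X³(1+η)) − π⁽¹⁾_K(3X³)`).
* `kappa σ₀ X η = κ = σ₀ η (3X)^{−1}` (p. 5).
* Calculus of the window (PROVED, [folklore]): `offsetLogIntegral_sub`,
  `offsetLogIntegral_window_bounds` (`(b−a)/log b ≤ Li b − Li a ≤ (b−a)/log a`),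
  `abs_offsetLogIntegral_window_sub_le` (`|Li(3X³(1+η)) − Li(3X³) − ηX³/log X| ≤ ηX³/(log X)²`
  for `X ≥ 2`, `0 < η ≤ 1`), `tendsto_exp_neg_mul_sqrt_mul_rpow`
  (`exp(−c√L) L^s → 0`).
* NAMED FACT `HeathBrown2001_firstDegreePIT` — (2.3), the prime ideal theorem for `K` with the
  de la Vallée-Poussin error term, for the first-degree count:
  `π⁽¹⁾_K(x) = Li(x) + O(x exp(−c√log x))`.
* NAMED FACT `HeathBrown2001_sieveComparison` — (2.4).
* PROVED `eventually_abs_normPrimeCount_sub_le`: (2.3) ⇒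
  `|π(ℬ) − ηX³/log X| ≤ 2ηX³/(log X)²` eventually, for `η = (log X)^{−c}` (the display between
  (2.3) and (2.4) on p. 5, `π(ℬ) = ηX³ (log X)^{−1} (1 + O((log X)^{−1}))`).
* PROVED **`HeathBrown2001_primePairCount_asymptotic_of`**: singular product convergent ∧ (2.3) ∧
  (2.4) ⇒ (2.2), and hence (`setOf_prime_cube_add_two_mul_cube_infinite_of_outline`) parity.S18.

## Faithfulness notes

* (2.3) is printed for `π_K(x)`, the count of *all* prime ideals of norm `≤ x`; only first-degree
  primes enter `π(ℬ)`, and the two counts differ by the number of prime ideals of degree `2` or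
  `3` with norm `≤ x`, at most `3π(√x) ≤ 3√x = o(x exp(−c√log x))`, so the first-degree form
  vendored here is equivalent to the printed one; it is what p. 5 uses. The elementary
  expression `∑_{p ≤ x} ν_p` for the first-degree count is the paper's own (pp. 6, 21); the bridge
  to Mathlib's `Ideal (𝓞 K)` / `Literature.NumberTheory.LFunctions.NumberField.primeIdealTheorem` (Dedekind–Kummer for
  `K = ℚ[X]/(X³ − 2)` off finitely many primes, `LFunctions/DegreeOnePrimes.lean`, plus the
  `O(√x)` count of higher-degree primes) is deliberately left to a sibling Proofs file.
  As in `PrimeIdealTheorem.lean`, `Li = Literature.offsetLogIntegral = ∫₂ˣ dt/log t` and the `O` is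
  written with an explicit constant for `x ≥ 2` (equivalent: both sides are locally bounded).
* (2.4) is a statement about the specific constant `σ₀` of the Theorem (through `κ`); it is
  vendored as "for every `σ₀` that is the limit of the ordered partial products of
  `∏_p (1 − (ν_p − 1)/p)` …" (there is at most one), the convergence itself being the separate
  fact `HeathBrown2001_singularProduct` (layer 1; p. 2 and (6.7), p. 37; discharged in
  `HeathBrownCubicPrimesProofs.lean` from the tree's `AZFG2020_lemma_5_3_5_holds`). The exponent of `η`:
  p. 21 takes `η = (log X)^{−2c₀}`; we quantify `∃ c > 0` as on p. 2. The `O`-term is the one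
  printed in (2.4) and re-derived on p. 21 (`≪ τ η²X²/log X`, `τ = (log log X)^{−ϖ}`, `ϖ = 1/6`).
* Nothing here is specific to the truth of (2.3)/(2.4): the reduction is unconditional
  real analysis (`Li` over the window `(3X³, 3X³(1+η)]`, `exp(−c√log X) = o((log X)^{−A})`).

## Mathlib / tree search

Mathlib: no logarithmic integral, no prime ideal theorem (searched `logIntegral`, `primeIdeal`,
`Chebotarev`); used: `intervalIntegral.integral_interval_sub_left`, `integral_mono_on`,
`tendsto_rpow_mul_exp_neg_mul_atTop_nhds_zero`, `Real.tendsto_sqrt_atTop`, `Asymptotics.IsBigO`.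
Tree: `Literature.NumberTheory.LFunctions.offsetLogIntegral` (`LFunctions/LogIntegral.lean`) is `Li`
(`Literature.NumberTheory.LFunctions.intervalIntegrable_inv_log_pow` in `LogIntegralProofs.lean` is the general integrability
lemma; its case `k = 1` is re-proved here in three lines to keep the import light);
`Literature.NumberTheory.LFunctions.NumberField.primeIdealTheorem` (`LFunctions/PrimeIdealTheorem.lean`) is the general `π_K`
statement of which (2.3) is the case `K = ℚ(2^{1/3})` (bridge not attempted in this file, see
above);
layer 1 (`HeathBrownCubicPrimes.lean`) supplies `ν_p`, `σ₀`'s partial products, `π(𝒜)`,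
`mainTerm` and the top reduction.
-/

noncomputable section

open Filter Asymptotics Finset Topology

namespace Literature.NumberTheory.Sieve.CubicPrimes

/-! ### `π_K^{(1)}`, `π(ℬ)` and `κ` -/

/-- `π⁽¹⁾_K(x) = ∑_{p ≤ x, p prime} ν_p`: the number of first-degree prime ideals of
`𝓞_K = ℤ[2^{1/3}]`, `K = ℚ(2^{1/3})`, with norm at most `x`, in the elementary form given by
Dedekind's theorem (the first-degree primes above `p` are `(p, n − 2^{1/3})` with
`n³ ≡ 2 (mod p)`, Heath-Brown p. 21; "`ν_p` … agrees with that defined in the statement of our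
theorem", p. 6). Junk-free for `x ≥ 0`; for `x < 0` the floor makes it `π⁽¹⁾_K(0) = 0`.
[cite: HeathBrownActa2001, §2 (2.3) and p. 21] -/
def firstDegreePrimeCount (x : ℝ) : ℕ :=
  ∑ p ∈ (Iic ⌊x⌋₊).filter Nat.Prime, cubeRootTwoCount p

/-- `π(ℬ) = π(ℬ)(X, η) = ∑_{3X³ < p ≤ 3X³(1+η), p prime} ν_p`: the number of primes, with
multiplicity, in Heath-Brown's comparison sequence `ℬ = {N(J) : N(J) ∈ (3X³, 3X³(1+η)]}`, `J`
over the integral ideals of `K = ℚ(2^{1/3})` (p. 5: "the primes in `ℬ` therefore correspond to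
first degree prime ideals"), i.e. the number of first-degree prime ideals with norm in the window,
written with `ν_p = #{P : N(P) = p}` (pp. 6, 21). [cite: HeathBrownActa2001, §2 p. 5] -/
def normPrimeCount (X η : ℝ) : ℕ :=
  ∑ p ∈ (Iic ⌊3 * X ^ 3 * (1 + η)⌋₊).filter
      (fun p : ℕ => p.Prime ∧ 3 * X ^ 3 < (p : ℝ) ∧ (p : ℝ) ≤ 3 * X ^ 3 * (1 + η)),
    cubeRootTwoCount p

/-- `κ = σ₀ η (3X)^{−1}`, the expected ratio `π(𝒜)/π(ℬ)` (display after (2.4), p. 5).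
[cite: HeathBrownActa2001, §2 (2.4)] -/
def kappa (σ₀ X η : ℝ) : ℝ :=
  σ₀ * η / (3 * X)

/-- `firstDegreePrimeCount` unfolded. [cite: HeathBrownActa2001, §2 (2.3) and p. 21] -/
theorem firstDegreePrimeCount_def (x : ℝ) :
    firstDegreePrimeCount x = ∑ p ∈ (Iic ⌊x⌋₊).filter Nat.Prime, cubeRootTwoCount p := rfl

/-- `normPrimeCount` unfolded. [cite: HeathBrownActa2001, §2 p. 5] -/
theorem normPrimeCount_def (X η : ℝ) :
    normPrimeCount X η = ∑ p ∈ (Iic ⌊3 * X ^ 3 * (1 + η)⌋₊).filter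
      (fun p : ℕ => p.Prime ∧ 3 * X ^ 3 < (p : ℝ) ∧ (p : ℝ) ≤ 3 * X ^ 3 * (1 + η)),
        cubeRootTwoCount p := rfl

/-- `kappa` unfolded. [cite: HeathBrownActa2001, §2 (2.4)] -/
theorem kappa_def (σ₀ X η : ℝ) : kappa σ₀ X η = σ₀ * η / (3 * X) := rfl

/-- Splitting `π⁽¹⁾_K` over a window: for `0 ≤ a ≤ b`,
`π⁽¹⁾_K(b) = π⁽¹⁾_K(a) + ∑_{a < p ≤ b} ν_p`. [folklore] -/
theorem firstDegreePrimeCount_eq_add_sum {a b : ℝ} (ha : 0 ≤ a) (hab : a ≤ b) :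
    firstDegreePrimeCount b = firstDegreePrimeCount a +
      ∑ p ∈ (Iic ⌊b⌋₊).filter (fun p : ℕ => p.Prime ∧ a < (p : ℝ) ∧ (p : ℝ) ≤ b),
        cubeRootTwoCount p := by
  have hb : 0 ≤ b := ha.trans hab
  unfold firstDegreePrimeCount
  rw [← sum_union]
  · refine sum_congr ?_ fun _ _ => rfl
    ext p
    simp only [mem_filter, mem_Iic, mem_union, Nat.le_floor_iff hb, Nat.le_floor_iff ha]
    constructor
    · rintro ⟨hpb, hp⟩
      by_cases hpa : (p : ℝ) ≤ a
      · exact Or.inl ⟨hpa, hp⟩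
      · exact Or.inr ⟨hpb, hp, lt_of_not_ge hpa, hpb⟩
    · rintro (⟨hpa, hp⟩ | ⟨hpb, hp, -, -⟩)
      · exact ⟨hpa.trans hab, hp⟩
      · exact ⟨hpb, hp⟩
  · rw [disjoint_left]
    rintro p hp1 hp2
    simp only [mem_filter, mem_Iic, Nat.le_floor_iff ha] at hp1 hp2
    exact absurd hp1.1 (not_le.2 hp2.2.2.1)

/-- `π(ℬ)(X, η) = π⁽¹⁾_K(3X³(1+η)) − π⁽¹⁾_K(3X³)` for `X, η ≥ 0` (p. 5: `π(ℬ)` is evaluated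
by differencing (2.3)). [cite: HeathBrownActa2001, §2 p. 5] -/
theorem normPrimeCount_eq_sub {X η : ℝ} (hX : 0 ≤ X) (hη : 0 ≤ η) :
    (normPrimeCount X η : ℝ) =
      firstDegreePrimeCount (3 * X ^ 3 * (1 + η)) - firstDegreePrimeCount (3 * X ^ 3) := by
  have ha : (0 : ℝ) ≤ 3 * X ^ 3 := by positivity
  have hab : 3 * X ^ 3 ≤ 3 * X ^ 3 * (1 + η) := le_mul_of_one_le_right ha (by linarith)
  rw [firstDegreePrimeCount_eq_add_sum ha hab, Nat.cast_add, add_sub_cancel_left]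
  rfl

/-! ### The logarithmic integral over a short window -/

/-- `t ↦ 1/log t` is interval integrable on any `[a, b] ⊂ (1, ∞)` (it is continuous there; the
case `k = 1` of `Literature.NumberTheory.LFunctions.intervalIntegrable_inv_log_pow` in `LogIntegralProofs.lean`, restated to keep
the imports to `LogIntegral`). [folklore] -/
theorem intervalIntegrable_inv_log {a b : ℝ} (ha : 1 < a) (hb : 1 < b) :
    IntervalIntegrable (fun t : ℝ => (Real.log t)⁻¹) MeasureTheory.volume a b := by
  have h1 : ∀ t ∈ Set.uIcc a b, 1 < t := fun t ht => by
    rcases Set.mem_uIcc.1 ht with h | h <;> linarith [h.1]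
  refine ContinuousOn.intervalIntegrable ((Real.continuousOn_log.mono fun t ht => ?_).inv₀ ?_)
  · simp only [Set.mem_compl_iff, Set.mem_singleton_iff]
    exact (zero_lt_one.trans (h1 t ht)).ne'
  · exact fun t ht => (Real.log_pos (h1 t ht)).ne'

/-- `Li b − Li a = ∫_a^b dt/log t` for `a, b > 1`. [folklore] -/
theorem offsetLogIntegral_sub {a b : ℝ} (ha : 1 < a) (hb : 1 < b) :
    LFunctions.offsetLogIntegral b - LFunctions.offsetLogIntegral a = ∫ t in a..b, (Real.log t)⁻¹ :=
  intervalIntegral.integral_interval_sub_left (intervalIntegrable_inv_log one_lt_two hb)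
    (intervalIntegrable_inv_log one_lt_two ha)

/-- Trivial bounds for `Li` over a window: `(b − a)/log b ≤ Li b − Li a ≤ (b − a)/log a` for
`1 < a ≤ b` (monotonicity of `1/log t`). [folklore] -/
theorem offsetLogIntegral_window_bounds {a b : ℝ} (ha : 1 < a) (hab : a ≤ b) :
    (b - a) * (Real.log b)⁻¹ ≤ LFunctions.offsetLogIntegral b - LFunctions.offsetLogIntegral a ∧
      LFunctions.offsetLogIntegral b - LFunctions.offsetLogIntegral a ≤ (b - a) * (Real.log a)⁻¹ := by
  have hb : 1 < b := ha.trans_le hab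
  rw [offsetLogIntegral_sub ha hb]
  have hi := intervalIntegrable_inv_log ha hb
  constructor
  · calc (b - a) * (Real.log b)⁻¹ = ∫ _ in a..b, (Real.log b)⁻¹ := by
          rw [intervalIntegral.integral_const, smul_eq_mul]
      _ ≤ ∫ t in a..b, (Real.log t)⁻¹ := by
          refine intervalIntegral.integral_mono_on hab intervalIntegrable_const hi fun t ht => ?_
          exact inv_anti₀ (Real.log_pos (ha.trans_le ht.1))
            (Real.log_le_log (zero_lt_one.trans (ha.trans_le ht.1)) ht.2)
  · calc ∫ t in a..b, (Real.log t)⁻¹ ≤ ∫ _ in a..b, (Real.log a)⁻¹ := by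
          refine intervalIntegral.integral_mono_on hab hi intervalIntegrable_const fun t ht => ?_
          exact inv_anti₀ (Real.log_pos ha) (Real.log_le_log (zero_lt_one.trans ha) ht.1)
      _ = (b - a) * (Real.log a)⁻¹ := by
          rw [intervalIntegral.integral_const, smul_eq_mul]

/-- The `Li`-mass of Heath-Brown's window: for `X ≥ 2` and `0 < η ≤ 1`,
`|Li(3X³(1+η)) − Li(3X³) − ηX³/log X| ≤ ηX³/(log X)²` (from the trivial bounds with
`3 log X ≤ log 3X³ ≤ log(3X³(1+η)) ≤ 3 log X + 2`). This is the main-term computation behind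
"`π(ℬ) = ηX³ (log X)^{−1} (1 + O((log X)^{−1}))`" on p. 5. [folklore] -/
theorem abs_offsetLogIntegral_window_sub_le {X η : ℝ} (hX : 2 ≤ X) (hη : 0 < η) (hη1 : η ≤ 1) :
    |LFunctions.offsetLogIntegral (3 * X ^ 3 * (1 + η)) - LFunctions.offsetLogIntegral (3 * X ^ 3)
        - η * X ^ 3 / Real.log X| ≤ η * X ^ 3 / Real.log X ^ 2 := by
  set L := Real.log X with hL
  set a := 3 * X ^ 3 with ha_def
  set b := 3 * X ^ 3 * (1 + η) with hb_def
  have hX1 : 1 < X := by linarith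
  have hX0 : 0 < X := by linarith
  have hLpos : 0 < L := Real.log_pos hX1
  have hL2 : Real.log 2 ≤ L := Real.log_le_log two_pos hX
  have hlog2 : (0.69 : ℝ) < Real.log 2 := Real.log_two_gt_d9.trans_le' (by norm_num)
  have hL69 : 0.69 < L := hlog2.trans_le hL2
  have hX3 : X ≤ X ^ 3 := le_self_pow₀ hX1.le three_ne_zero
  have ha1 : 1 < a := by rw [ha_def]; nlinarith
  have hab : a ≤ b := by rw [hb_def, ha_def]; nlinarith [pow_pos hX0 3]
  have hba : b - a = 3 * X ^ 3 * η := by rw [hb_def, ha_def]; ring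
  -- `log a = log 3 + 3 L ≥ 3 L`, `log b ≤ 3 L + 2`
  have hloga : Real.log a = Real.log 3 + 3 * L := by
    rw [ha_def, Real.log_mul (by norm_num) (pow_pos hX0 3).ne', Real.log_pow]; simp [hL]
  have hlog3 : 0 ≤ Real.log 3 := Real.log_nonneg (by norm_num)
  have hlog6 : Real.log 3 + Real.log (1 + η) ≤ 2 := by
    rw [← Real.log_mul (by norm_num) (by linarith)]
    calc Real.log (3 * (1 + η)) ≤ Real.log 6 :=
          Real.log_le_log (by linarith) (by linarith)
      _ ≤ 2 := by
          rw [Real.log_le_iff_le_exp (by norm_num)]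
          have h1 := Real.exp_one_gt_d9
          have h2 : Real.exp 2 = Real.exp 1 * Real.exp 1 := by rw [← Real.exp_add]; norm_num
          nlinarith
  have hlogb : Real.log b = Real.log 3 + 3 * L + Real.log (1 + η) := by
    rw [hb_def, Real.log_mul (by positivity) (by linarith), ← ha_def, hloga]
  have hloga_ge : 3 * L ≤ Real.log a := by rw [hloga]; linarith
  have hlogb_le : Real.log b ≤ 3 * L + 2 := by rw [hlogb]; linarith
  have hlogb_pos : 0 < Real.log b := Real.log_pos (ha1.trans_le hab)
  obtain ⟨hlow, hupp⟩ := offsetLogIntegral_window_bounds ha1 hab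
  have hX3pos : 0 < X ^ 3 := pow_pos hX0 3
  have hηX : 0 < η * X ^ 3 := mul_pos hη hX3pos
  -- upper bound: `Li b − Li a ≤ 3X³η/(3L) = ηX³/L`
  have hU : LFunctions.offsetLogIntegral b - LFunctions.offsetLogIntegral a ≤ η * X ^ 3 / L := by
    calc LFunctions.offsetLogIntegral b - LFunctions.offsetLogIntegral a ≤ (b - a) * (Real.log a)⁻¹ := hupp
      _ ≤ (3 * X ^ 3 * η) * (3 * L)⁻¹ := by
          rw [hba]
          exact mul_le_mul_of_nonneg_left (inv_anti₀ (by positivity) hloga_ge) (by positivity)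
      _ = η * X ^ 3 / L := by field_simp
  -- lower bound: `Li b − Li a ≥ 3X³η/(3L+2) ≥ ηX³/L − ηX³/L²`
  have hD : η * X ^ 3 / L - η * X ^ 3 / L ^ 2 ≤ LFunctions.offsetLogIntegral b - LFunctions.offsetLogIntegral a := by
    calc η * X ^ 3 / L - η * X ^ 3 / L ^ 2 ≤ (3 * X ^ 3 * η) * (3 * L + 2)⁻¹ := by
          rw [div_sub_div _ _ hLpos.ne' (pow_pos hLpos 2).ne', div_le_iff₀ (by positivity),
            ← div_eq_mul_inv, div_mul_eq_mul_div, le_div_iff₀ (by positivity)]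
          nlinarith [mul_pos hηX hLpos, mul_pos (mul_pos hηX hLpos) hLpos]
      _ ≤ (b - a) * (Real.log b)⁻¹ := by
          rw [hba]
          exact mul_le_mul_of_nonneg_left (inv_anti₀ hlogb_pos hlogb_le) (by positivity)
      _ ≤ LFunctions.offsetLogIntegral b - LFunctions.offsetLogIntegral a := hlow
  rw [abs_le]
  constructor <;> linarith

/-- `exp(−c √L) · L^s → 0` as `L → ∞`, for `c > 0` (substitute `L = u²` in
`u^{2s} e^{−cu} → 0`): the de la Vallée-Poussin error term beats every power of `log`.
[folklore] -/
theorem tendsto_exp_neg_mul_sqrt_mul_rpow {c : ℝ} (hc : 0 < c) (s : ℝ) :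
    Tendsto (fun L : ℝ => Real.exp (-c * Real.sqrt L) * L ^ s) atTop (𝓝 0) := by
  have h := (tendsto_rpow_mul_exp_neg_mul_atTop_nhds_zero (2 * s) c hc).comp
    Real.tendsto_sqrt_atTop
  refine h.congr' ?_
  filter_upwards [eventually_ge_atTop (0 : ℝ)] with L hL
  simp only [Function.comp_def]
  rw [Real.sqrt_eq_rpow, ← Real.rpow_mul hL, mul_comm]
  congr 1
  ring

/-! ### The named facts (2.3) and (2.4) -/

/-- **Heath-Brown (2.3): the prime ideal theorem for `K = ℚ(2^{1/3})` with the
de la Vallée-Poussin error term**, "`π_K(x) = Li(x) + O(x exp{−c√(log x)})` for a suitable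
positive constant `c`" (p. 5; Landau 1903), stated for the first-degree count
`π⁽¹⁾_K(x) = ∑_{p ≤ x} ν_p` (`firstDegreePrimeCount`; the prime ideals of degree `2, 3` with norm
`≤ x` number at most `2π(√x) = o(x exp(−c√log x))`, so this is equivalent to the printed form,
and it is the form p. 5 applies to `π(ℬ)`), with `Li = ∫₂ˣ dt/log t` and an explicit constant
for `x ≥ 2` in place of the `O`: there are `c > 0` and `C` with
`|π⁽¹⁾_K(x) − Li(x)| ≤ C x exp(−c√(log x))` for all `x ≥ 2`.
[cite: HeathBrownActa2001, §2 (2.3)] [cite: LandauMathAnn1903, Primidealsatz] -/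
def HeathBrown2001_firstDegreePIT : Prop :=
  ∃ c : ℝ, 0 < c ∧ ∃ C : ℝ, ∀ x : ℝ, 2 ≤ x →
    |(firstDegreePrimeCount x : ℝ) - LFunctions.offsetLogIntegral x| ≤
      C * x * Real.exp (-c * Real.sqrt (Real.log x))

/-- **Heath-Brown (2.4): the sieve comparison of `𝒜` with `ℬ`** (p. 5, established on p. 21 from
(3.15) with `η = (log X)^{−2c₀}`, `ϖ = 1/6`): with `σ₀ = ∏_p (1 − (ν_p − 1)/p)` (the limit of the
ordered partial products — at most one such number; its existence is the separate fact
`HeathBrown2001_singularProduct`) there is `c > 0` such that, for `η = (log X)^{−c}` and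
`κ = σ₀ η (3X)^{−1}`,
`π(𝒜) = κ π(ℬ) + O(η² X² (log X)^{−1} (log log X)^{−1/6})` as `X → ∞`.
This single display packages the whole sieve argument of §§3–13 (Type I bounds Lemmas 2.1, 2.2,
3.2, 3.3; Fundamental Lemma 3.5; upper-bound sieve Lemma 3.6; Lemma 3.7; the Siegel–Walfisz
analogue Lemma 3.8; Lemma 3.9; the Type II large-sieve bound Lemma 3.10).
[cite: HeathBrownActa2001, §2 (2.4) and p. 21] -/
def HeathBrown2001_sieveComparison : Prop :=
  ∀ σ₀ : ℝ, Tendsto singularProductPartial atTop (𝓝 σ₀) → ∃ c : ℝ, 0 < c ∧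
    (fun X : ℝ => (primePairCount X (Real.log X ^ (-c)) : ℝ) -
        kappa σ₀ X (Real.log X ^ (-c)) * normPrimeCount X (Real.log X ^ (-c))) =O[atTop]
      fun X : ℝ => (Real.log X ^ (-c)) ^ 2 * X ^ 2 / Real.log X *
        Real.log (Real.log X) ^ (-(1 / 6 : ℝ))

/-! ### The reduction -/

/-- **From (2.3): `π(ℬ) = ηX³ (log X)^{−1} (1 + O((log X)^{−1}))`** (the display between (2.3)
and (2.4), p. 5), quantitatively: for `η = (log X)^{−c}`, `c > 0`, and all sufficiently large `X`,
`|π(ℬ) − ηX³/log X| ≤ 2ηX³/(log X)²` (`ηX³/(log X)²` from the `Li`-window,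
`12 C X³ exp(−c'√log X) ≤ ηX³/(log X)²` from the error term of (2.3)).
[cite: HeathBrownActa2001, §2 p. 5] -/
theorem eventually_abs_normPrimeCount_sub_le (h23 : HeathBrown2001_firstDegreePIT) {c : ℝ}
    (hc : 0 < c) :
    ∀ᶠ X : ℝ in atTop,
      |(normPrimeCount X (Real.log X ^ (-c)) : ℝ) - Real.log X ^ (-c) * X ^ 3 / Real.log X| ≤
        2 * (Real.log X ^ (-c) * X ^ 3 / Real.log X ^ 2) := by
  obtain ⟨c', hc', C, hC⟩ := h23
  set C' := max C 0 with hC'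
  have hC'0 : 0 ≤ C' := le_max_right _ _
  have hC1 : ∀ x : ℝ, 2 ≤ x → |(firstDegreePrimeCount x : ℝ) - LFunctions.offsetLogIntegral x| ≤
      C' * x * Real.exp (-c' * Real.sqrt (Real.log x)) := fun x hx =>
    (hC x hx).trans (by gcongr; exact le_max_left _ _)
  -- the error term `12 C' X³ exp(−c' √log X)` is eventually `≤ ηX³/(log X)²`
  have hpos : (0 : ℝ) < 1 / (12 * C' + 1) := by positivity
  have hev : ∀ᶠ L : ℝ in atTop, Real.exp (-c' * Real.sqrt L) * L ^ (c + 2) ≤ 1 / (12 * C' + 1) :=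
    (tendsto_exp_neg_mul_sqrt_mul_rpow hc' (c + 2)).eventually (ge_mem_nhds hpos)
  filter_upwards [Real.tendsto_log_atTop.eventually hev, eventually_ge_atTop (2 : ℝ),
    Real.tendsto_log_atTop.eventually (eventually_ge_atTop (1 : ℝ))] with X hXev hX2 hL1
  set L := Real.log X with hL
  set η := L ^ (-c) with hη
  have hX0 : 0 < X := by linarith
  have hX1 : 1 < X := by linarith
  have hLpos : 0 < L := by linarith
  have hη0 : 0 < η := Real.rpow_pos_of_pos hLpos _
  have hη1 : η ≤ 1 := by
    rw [hη, Real.rpow_neg hLpos.le]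
    exact inv_le_one_of_one_le₀ (Real.one_le_rpow hL1 hc.le)
  have hX3pos : 0 < X ^ 3 := pow_pos hX0 3
  set a := 3 * X ^ 3 with ha
  set b := 3 * X ^ 3 * (1 + η) with hb
  have hXX3 : X ≤ X ^ 3 := le_self_pow₀ hX1.le three_ne_zero
  have ha2 : 2 ≤ a := by rw [ha]; nlinarith
  have hab : a ≤ b := by rw [hb, ha]; nlinarith
  have hb2 : 2 ≤ b := ha2.trans hab
  have hb6 : b ≤ 6 * X ^ 3 := by rw [hb]; nlinarith
  -- (i) the `Li` window
  have hLi := abs_offsetLogIntegral_window_sub_le hX2 hη0 hη1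
  -- (ii) the two PIT errors, each `≤ 6 C' X³ exp(−c' √L)`
  have hexp_mono : ∀ y : ℝ, a ≤ y → Real.exp (-c' * Real.sqrt (Real.log y)) ≤
      Real.exp (-c' * Real.sqrt L) := by
    intro y hy
    have hXy : X ≤ y := by rw [ha] at hy; nlinarith
    apply Real.exp_le_exp.2
    have := Real.sqrt_le_sqrt (Real.log_le_log hX0 hXy)
    nlinarith
  have hEb : |(firstDegreePrimeCount b : ℝ) - LFunctions.offsetLogIntegral b| ≤
      6 * C' * X ^ 3 * Real.exp (-c' * Real.sqrt L) := by
    refine (hC1 b hb2).trans ?_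
    calc C' * b * Real.exp (-c' * Real.sqrt (Real.log b))
        ≤ C' * (6 * X ^ 3) * Real.exp (-c' * Real.sqrt L) :=
          mul_le_mul (mul_le_mul_of_nonneg_left hb6 hC'0) (hexp_mono b hab) (Real.exp_pos _).le
            (by positivity)
      _ = 6 * C' * X ^ 3 * Real.exp (-c' * Real.sqrt L) := by ring
  have hEa : |(firstDegreePrimeCount a : ℝ) - LFunctions.offsetLogIntegral a| ≤
      6 * C' * X ^ 3 * Real.exp (-c' * Real.sqrt L) := by
    refine (hC1 a ha2).trans ?_
    calc C' * a * Real.exp (-c' * Real.sqrt (Real.log a))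
        ≤ C' * (6 * X ^ 3) * Real.exp (-c' * Real.sqrt L) :=
          mul_le_mul (mul_le_mul_of_nonneg_left (hab.trans hb6) hC'0) (hexp_mono a le_rfl)
            (Real.exp_pos _).le (by positivity)
      _ = 6 * C' * X ^ 3 * Real.exp (-c' * Real.sqrt L) := by ring
  -- (iii) `12 C' X³ exp(−c'√L) ≤ ηX³/L²`
  have hE : 12 * C' * X ^ 3 * Real.exp (-c' * Real.sqrt L) ≤ η * X ^ 3 / L ^ 2 := by
    have hLc : 0 < L ^ (c + 2) := Real.rpow_pos_of_pos hLpos _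
    have hηL : η / L ^ 2 = (L ^ (c + 2))⁻¹ := by
      rw [hη, Real.rpow_neg hLpos.le, Real.rpow_add hLpos, Real.rpow_two, mul_inv, div_eq_mul_inv]
    have h1 : 12 * C' * Real.exp (-c' * Real.sqrt L) ≤ (L ^ (c + 2))⁻¹ := by
      rw [inv_eq_one_div, le_div_iff₀ hLc]
      calc 12 * C' * Real.exp (-c' * Real.sqrt L) * L ^ (c + 2)
          = 12 * C' * (Real.exp (-c' * Real.sqrt L) * L ^ (c + 2)) := by ring
        _ ≤ 12 * C' * (1 / (12 * C' + 1)) := by gcongr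
        _ ≤ 1 := by rw [mul_one_div, div_le_one (by positivity)]; linarith
    calc 12 * C' * X ^ 3 * Real.exp (-c' * Real.sqrt L)
        = (12 * C' * Real.exp (-c' * Real.sqrt L)) * X ^ 3 := by ring
      _ ≤ (L ^ (c + 2))⁻¹ * X ^ 3 := by gcongr
      _ = η * X ^ 3 / L ^ 2 := by rw [← hηL]; ring
  -- assemble
  rw [normPrimeCount_eq_sub hX0.le hη0.le]
  have key : |(firstDegreePrimeCount b : ℝ) - firstDegreePrimeCount a - η * X ^ 3 / L| ≤
      |LFunctions.offsetLogIntegral b - LFunctions.offsetLogIntegral a - η * X ^ 3 / L| +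
        |(firstDegreePrimeCount b : ℝ) - LFunctions.offsetLogIntegral b| +
        |(firstDegreePrimeCount a : ℝ) - LFunctions.offsetLogIntegral a| := by
    have e : (firstDegreePrimeCount b : ℝ) - firstDegreePrimeCount a - η * X ^ 3 / L =
        (LFunctions.offsetLogIntegral b - LFunctions.offsetLogIntegral a - η * X ^ 3 / L) +
          ((firstDegreePrimeCount b : ℝ) - LFunctions.offsetLogIntegral b) -
          ((firstDegreePrimeCount a : ℝ) - LFunctions.offsetLogIntegral a) := by ring
    rw [e]
    exact (abs_sub _ _).trans (add_le_add (abs_add_le _ _) le_rfl)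
  calc |(firstDegreePrimeCount b : ℝ) - firstDegreePrimeCount a - η * X ^ 3 / L|
      ≤ η * X ^ 3 / L ^ 2 + 6 * C' * X ^ 3 * Real.exp (-c' * Real.sqrt L) +
          6 * C' * X ^ 3 * Real.exp (-c' * Real.sqrt L) := by
        refine key.trans (add_le_add (add_le_add hLi hEb) hEa)
    _ ≤ 2 * (η * X ^ 3 / L ^ 2) := by linarith

/-- **"In order to establish (2.2) it therefore suffices to show (2.4)"** (Heath-Brown, p. 5):
the convergence of the singular product, the prime ideal theorem (2.3) and the sieve comparison
(2.4) imply the quantitative theorem (2.2) (`HeathBrown2001_primePairCount_asymptotic`), with the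
same `c` and `σ₀`. Proof: `π(𝒜) − M = (π(𝒜) − κπ(ℬ)) + κ(π(ℬ) − ηX³/log X)` with
`κ ηX³/log X = M = σ₀η²X²/(3 log X)` exactly; the first bracket is `O(M (log log X)^{−1/6})` by
(2.4), the second is `≤ 2M/log X ≤ 2M (log log X)^{−1/6}` by (2.3).
[cite: HeathBrownActa2001, §2 pp. 4–5] -/
theorem HeathBrown2001_primePairCount_asymptotic_of (hσ : HeathBrown2001_singularProduct)
    (h23 : HeathBrown2001_firstDegreePIT) (h24 : HeathBrown2001_sieveComparison) :
    HeathBrown2001_primePairCount_asymptotic := by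
  obtain ⟨σ₀, hσ₀, hlim⟩ := hσ
  obtain ⟨c, hc, hO⟩ := h24 σ₀ hlim
  refine ⟨c, hc, σ₀, hσ₀, hlim, ?_⟩
  obtain ⟨C₁, hC₁⟩ := hO.bound
  have hB := eventually_abs_normPrimeCount_sub_le h23 hc
  refine IsBigO.of_bound (3 * ‖C₁‖ / σ₀ + 2) ?_
  filter_upwards [hC₁, hB, eventually_ge_atTop (2 : ℝ),
    Real.tendsto_log_atTop.eventually (eventually_ge_atTop (1 : ℝ)),
    (Real.tendsto_log_atTop.comp Real.tendsto_log_atTop).eventually (eventually_ge_atTop (1 : ℝ))]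
    with X hC₁X hBX hX2 hL1 hLL1
  set L := Real.log X with hL
  set η := L ^ (-c) with hη
  set ℓ := Real.log L ^ (-(1 / 6 : ℝ)) with hℓ
  have hLL1' : 1 ≤ Real.log L := by simpa [Function.comp_def] using hLL1
  have hX0 : 0 < X := by linarith
  have hX1 : 1 < X := by linarith
  have hLpos : 0 < L := by linarith
  have hη0 : 0 < η := Real.rpow_pos_of_pos hLpos _
  have hℓ0 : 0 < ℓ := Real.rpow_pos_of_pos (by linarith) _
  have hM : 0 < mainTerm c σ₀ X := mainTerm_pos hσ₀ hX1
  have hMdef : mainTerm c σ₀ X = σ₀ * η ^ 2 * X ^ 2 / (3 * L) := rfl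
  -- `1/L ≤ ℓ = (log L)^{-1/6}` since `(log L)^{1/6} ≤ log L ≤ L`
  have hLℓ : L⁻¹ ≤ ℓ := by
    rw [hℓ, Real.rpow_neg (by linarith)]
    refine inv_anti₀ (Real.rpow_pos_of_pos (by linarith) _) ?_
    calc Real.log L ^ (1 / 6 : ℝ) ≤ Real.log L ^ (1 : ℝ) :=
          Real.rpow_le_rpow_of_exponent_le hLL1' (by norm_num)
      _ = Real.log L := Real.rpow_one _
      _ ≤ L := Real.log_le_self hLpos.le
  -- the printed error term is `(3/σ₀) · M · ℓ`
  have hE1 : ‖(η ^ 2 * X ^ 2 / L * ℓ : ℝ)‖ = 3 / σ₀ * (mainTerm c σ₀ X * ℓ) := by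
    rw [Real.norm_of_nonneg (by positivity), hMdef]
    field_simp
  -- `κ · ηX³/L = M` and `κ · ηX³/L² = M/L`
  have hκ : kappa σ₀ X η * (η * X ^ 3 / L) = mainTerm c σ₀ X := by
    rw [kappa_def, hMdef]; field_simp
  have hκ' : kappa σ₀ X η * (2 * (η * X ^ 3 / L ^ 2)) = 2 * mainTerm c σ₀ X * L⁻¹ := by
    rw [kappa_def, hMdef]; field_simp
  have hκ0 : 0 ≤ kappa σ₀ X η := by rw [kappa_def]; positivity
  -- decomposition `π(𝒜) − M = (π(𝒜) − κπ(ℬ)) + κ (π(ℬ) − ηX³/L)`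
  have hdec : (primePairCount X η : ℝ) - mainTerm c σ₀ X =
      ((primePairCount X η : ℝ) - kappa σ₀ X η * normPrimeCount X η) +
        kappa σ₀ X η * ((normPrimeCount X η : ℝ) - η * X ^ 3 / L) := by
    rw [mul_sub, hκ]; ring
  rw [Real.norm_eq_abs, hdec, Real.norm_of_nonneg (by positivity : (0 : ℝ) ≤ mainTerm c σ₀ X * ℓ)]
  calc |((primePairCount X η : ℝ) - kappa σ₀ X η * normPrimeCount X η) +
          kappa σ₀ X η * ((normPrimeCount X η : ℝ) - η * X ^ 3 / L)|
      ≤ |(primePairCount X η : ℝ) - kappa σ₀ X η * normPrimeCount X η| +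
          kappa σ₀ X η * |(normPrimeCount X η : ℝ) - η * X ^ 3 / L| := by
        refine (abs_add_le _ _).trans (add_le_add le_rfl ?_)
        rw [abs_mul, abs_of_nonneg hκ0]
    _ ≤ C₁ * ‖(η ^ 2 * X ^ 2 / L * ℓ : ℝ)‖ + kappa σ₀ X η * (2 * (η * X ^ 3 / L ^ 2)) := by
        have h1 : |(primePairCount X η : ℝ) - kappa σ₀ X η * normPrimeCount X η| ≤
            C₁ * ‖(η ^ 2 * X ^ 2 / L * ℓ : ℝ)‖ := by simpa only [Real.norm_eq_abs] using hC₁X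
        gcongr
    _ ≤ ‖C₁‖ * ‖(η ^ 2 * X ^ 2 / L * ℓ : ℝ)‖ + kappa σ₀ X η * (2 * (η * X ^ 3 / L ^ 2)) := by
        gcongr; exact Real.le_norm_self _
    _ = 3 * ‖C₁‖ / σ₀ * (mainTerm c σ₀ X * ℓ) + 2 * mainTerm c σ₀ X * L⁻¹ := by
        rw [hE1, hκ']; ring
    _ ≤ 3 * ‖C₁‖ / σ₀ * (mainTerm c σ₀ X * ℓ) + 2 * mainTerm c σ₀ X * ℓ := by
        gcongr
    _ = (3 * ‖C₁‖ / σ₀ + 2) * (mainTerm c σ₀ X * ℓ) := by ring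

/-- **Layer 2 of parity.S18**: singular product convergent ∧ (2.3) ∧ (2.4) ⇒ there are
infinitely many primes `x³ + 2y³` with `x, y ≥ 1` (through layer 1,
`setOf_prime_cube_add_two_mul_cube_infinite_of_heathBrown2001`).
[cite: HeathBrownActa2001, §2 pp. 4–5] -/
theorem _root_.Literature.NumberTheory.Sieve.setOf_prime_cube_add_two_mul_cube_infinite_of_outline
    (hσ : HeathBrown2001_singularProduct) (h23 : HeathBrown2001_firstDegreePIT)
    (h24 : HeathBrown2001_sieveComparison) :
    Literature.NumberTheory.Sieve.setOf_prime_cube_add_two_mul_cube_infinite :=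
  Literature.NumberTheory.Sieve.setOf_prime_cube_add_two_mul_cube_infinite_of_heathBrown2001
    (HeathBrown2001_primePairCount_asymptotic_of hσ h23 h24)

end Literature.NumberTheory.Sieve.CubicPrimes

end
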